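import Summits.QuantumFields.BalabanUV.T4Continuum.Support.NE7K1LinStripClass

/-!
# NE7K1LinStripClassCauchy — row NE7 (node U5), candidate route HOM, path H1L, cell K1-lin(s): NEEDS-ESTIMATE #E1, R-E1 TRANCHE A —
# THE UNIFORM ZERO-FREE STRIP OF THE REGROUPED DENOMINATOR OVER THE CLASS `S` (b04's `B4StripCauchy` §6 RE-TYPED: Cauchy's
# estimate ⇒ imaginary Lipschitz ⇒ `c_S ≤ ‖ES n σ a p‖` on `Strip d κ_S`, constants in `(d, a₋, a₊, r, C_up)` ONLY), and the
# `2π`-SHIFT LAW of `ES` (b05's `E_tr` over the class)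

Lineage `b2b-balaban-t4-ne7-p2` (CRUX PROVER NE7 #2), generation 76; file 63.  File 62 typed the class `SymbS n σ r C_S C_up` and over it
the regrouped denominator `ES n σ a` with real positivity `a(4∕π²)^d ≤ ‖ES(s)‖`, the fat bound `‖ES‖ ≤ M_S`, slice holomorphy, the
shifted floors and the edge positivity.  THIS FILE ([folklore]; b04's abstract lemmas `imLipschitz_of_fat` ∕ `strip_lower_bound` BY NAME):

* §1 **`ES_imLipschitz`**: `‖ES(p) − ES(Re p)‖ ≤ (M_S∕r)·Σ_μ|Im p_μ|` on every strip of half-width `κ ≤ r`;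
  **`ES_strip_lower`**: `a(4∕π²)^d∕2 ≤ ‖ES(p)‖` on `Strip d κ` as soon as `(M_S∕r)·d·κ ≤ a(4∕π²)^d∕2`.
* §2 EXPLICIT CONSTANTS `cS d a₋ = a₋(4∕π²)^d∕2`, `LamS = M_S(d, max(|a₋|,|a₊|), C_up)∕r`, `kappaS = min r (cS∕(LamS·d + 1))` and
  **`uniformStrip`**: for EVERY `n ≥ 1`, EVERY `σ ∈ S(n; r, C_S, C_up)`, EVERY `a ∈ [a₋, a₊]` (`0 < a₋`):
  `cS d a₋ ≤ ‖ES n σ a p‖` on `Strip d (kappaS d a₋ a₊ C_up r)` — the zero-free strip is UNIFORM IN THE CLASS (it sees `σ` only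
  through `(r, C_up)`; `C_S` enters only through the admissibility `16C_Sdr² ≤ 1`); `kappaS_pos ∕ kappaS_le`; the packaged strip data
  **`strip_data`** (`ES ≠ 0`, the two-sided bounds, joint holomorphy on the strip, `Strip ⊆ Fat`).
* §3 THE SHIFT LAW: `periodic_mul` (`2πn·m`-periodicity), **`shift_tr_eq_update`** + **`sigma_shift_tr`**
  (`σ(shift k (p + 2πe_μ)) = σ(shift (σ_μ k) p)` — the residue relabelling, the wrap `k_μ = n−1 ↦ 0` absorbed by (S1)), the periodic
  factor **`BfacS`** `= 1 + aΣ_k U_k∕σ(· + 2πk)` with `ES = σ·BfacS` (`ES_eq_mul_BfacS`), `BfacS_tr`, and **`ES_tr`**: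
  `ES(p + 2πe_μ)·σ(p) = σ(p + 2πe_μ)·ES(p)` off `p_μ ∈ {0, −2π}` — the input of the side periodicity of the (2.48) multiplier over S
  (tranche C).

HONEST FRAMING: [folklore] — Cauchy's estimate on coordinate discs (through b04's abstract lemma) and finite reindexing; constants
existence-grade; no symbol is asserted to be in the class here (instances: files 64–65); nothing of Bałaban's asserted; no `sorry`.
Census only; NE7 NOT PRINTED ∕ NOT PROVED; spine 0∕9; FIXED FINITE T⁴, rung (B)+1; NOT infinite volume, NOT mass gap, NOT Clay.  HONEST
DEPENDENCY: continuum YM on T⁴ ⇐ BetaPertH ∧ nine spine estimates (0/9 proved); BetaPertH ⇐ (D1) ∧ (D4) ∧ CAP+tail; G-an2-4 gates asym,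
D1 and NE2/3/4.
-/

noncomputable section

open Finset Complex Set

namespace Summit.QuantumFields.BalabanUV.T4Continuum.NE7K1LinStripClassCauchy

open Literature.MathematicalPhysics.QuantumFieldTheory.Balaban1983to89
open Literature.MathematicalPhysics.QuantumFieldTheory.Balaban1983to89.B4Strip
open Literature.MathematicalPhysics.QuantumFieldTheory.Balaban1983to89.B4StripCauchy
open Literature.MathematicalPhysics.QuantumFieldTheory.Balaban1983to89.B4StripSums
open Literature.MathematicalPhysics.QuantumFieldTheory.Balaban1983to89.B5Strip145Analytic
open NE7K1LinStripClass

variable {d : ℕ} {n : ℕ} {σ : (Fin d → ℂ) → ℂ} {r CS Cup : ℝ}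

/-! ### §1 The imaginary-direction Lipschitz bound and the strip lower bound -/

/-- **Lemma C over the class**: `‖ES(p) − ES(Re p)‖ ≤ (M_S∕r)·Σ_μ|Im p_μ|` on every strip `|Im p_μ| ≤ κ ≤ r` (b04's
`imLipschitz_of_fat` fed with file 62's slice holomorphy and fat bound). [folklore] -/
theorem ES_imLipschitz [NeZero n] (h : SymbS n σ r CS Cup) (a : ℝ) {κ : ℝ} (hκ0 : 0 ≤ κ) (hκ : κ ≤ r) :
    ∀ p ∈ Strip d κ, ‖ES n σ a p - ES n σ a (ofRealVec (reVec p))‖ ≤ boundMS d |a| Cup / r * ∑ μ, |(p μ).im| :=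
  imLipschitz_of_fat (ES n σ a) h.r_pos hκ0 hκ (fun _ hq μ => h.differentiableAt_ES_slice a hq μ)
    (fun _ hq => h.norm_ES_le a hq)

/-- the strip lower bound over the class: real positivity + imaginary Lipschitz ⇒ `a(4∕π²)^d∕2 ≤ ‖ES(p)‖` on `Strip d κ` whenever
`(M_S∕r)·d·κ ≤ a(4∕π²)^d∕2` (b04's `E_lower_of_ImLipschitz` over S). [folklore] -/
theorem ES_strip_lower [NeZero n] (h : SymbS n σ r CS Cup) (hn : 1 ≤ n) {a : ℝ} (ha : 0 ≤ a) {κ : ℝ}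
    (hκ0 : 0 ≤ κ) (hκ : κ ≤ r) (hsmall : boundMS d |a| Cup / r * (d * κ) ≤ a * (4 / Real.pi ^ 2) ^ d / 2) :
    ∀ p ∈ Strip d κ, a * (4 / Real.pi ^ 2) ^ d / 2 ≤ ‖ES n σ a p‖ := by
  apply strip_lower_bound (ES n σ a) _ (boundMS d |a| Cup / r) κ _ (ES_imLipschitz h a hκ0 hκ)
    (div_nonneg (boundMS_nonneg d (abs_nonneg a) h.cup_nonneg) h.r_pos.le) hsmall
  intro s hs
  have := h.ES_re_ge hn ha s hs
  linarith

/-! ### §2 Explicit constants and the uniform strip -/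

/-- the strip floor `c_S = a₋(4∕π²)^d∕2`. [folklore] -/
def cS (d : ℕ) (aminus : ℝ) : ℝ := aminus * (4 / Real.pi ^ 2) ^ d / 2

/-- `c_S > 0` for `a₋ > 0`. [folklore] -/
theorem cS_pos (d : ℕ) {aminus : ℝ} (ha : 0 < aminus) : 0 < cS d aminus := by unfold cS; positivity

/-- the Lipschitz constant `Λ_S = M_S(d, A, C_up)∕r`. [folklore] -/
def LamS (d : ℕ) (A Cup r : ℝ) : ℝ := boundMS d A Cup / r

/-- `Λ_S ≥ 0`. [folklore] -/
theorem LamS_nonneg (d : ℕ) {A Cup r : ℝ} (hA : 0 ≤ A) (hC : 0 ≤ Cup) (hr : 0 ≤ r) : 0 ≤ LamS d A Cup r :=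
  div_nonneg (boundMS_nonneg d hA hC) hr

/-- THE STRIP HALF-WIDTH OF THE CLASS: `κ_S = min r (c_S ∕ (Λ_S·d + 1))`, `Λ_S` at `A = max(|a₋|, |a₊|)` — a function of
`(d, a₋, a₊, C_up, r)` ALONE. [folklore] -/
def kappaS (d : ℕ) (aminus aplus Cup r : ℝ) : ℝ :=
  min r (cS d aminus / (LamS d (max |aminus| |aplus|) Cup r * d + 1))

/-- `κ_S > 0`. [folklore] -/
theorem kappaS_pos (d : ℕ) {aminus aplus Cup r : ℝ} (ha : 0 < aminus) (hC : 0 ≤ Cup) (hr : 0 < r) :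
    0 < kappaS d aminus aplus Cup r := by
  unfold kappaS
  have hΛ := LamS_nonneg d (le_max_of_le_left (abs_nonneg aminus)) hC hr.le (A := max |aminus| |aplus|)
  have := cS_pos d ha
  exact lt_min hr (by positivity)

/-- `κ_S ≤ r`. [folklore] -/
theorem kappaS_le (d : ℕ) (aminus aplus Cup r : ℝ) : kappaS d aminus aplus Cup r ≤ r := min_le_left _ _

/-- **THE UNIFORM ZERO-FREE STRIP OVER THE CLASS** (b04's `uniformStrip_explicit` re-typed): for `0 < a₋ ≤ a ≤ a₊`, EVERY `n ≥ 1`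
and EVERY `σ ∈ S(n; r, C_S, C_up)`: `c_S(d, a₋) ≤ ‖ES n σ a p‖` on `Strip d κ_S(d, a₋, a₊, C_up, r)`.  The constants see the
symbol only through the class constants — in particular they are the SAME for every member of a family `{σ_s}_s ⊂ S` and
every mesh `n`. [folklore] -/
theorem uniformStrip [NeZero n] (h : SymbS n σ r CS Cup) {aminus aplus a : ℝ} (ha : 0 < aminus)
    (ha1 : aminus ≤ a) (ha2 : a ≤ aplus) :
    ∀ p ∈ Strip d (kappaS d aminus aplus Cup r), cS d aminus ≤ ‖ES n σ a p‖ := by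
  have hn : 1 ≤ n := Nat.one_le_iff_ne_zero.mpr (NeZero.ne n)
  have ha0 : 0 ≤ a := ha.le.trans ha1
  have hC := h.cup_nonneg
  set Λ := LamS d (max |aminus| |aplus|) Cup r with hΛdef
  set κ := kappaS d aminus aplus Cup r with hκdef
  have hΛ0 : 0 ≤ Λ := LamS_nonneg d (le_max_of_le_left (abs_nonneg aminus)) hC h.r_pos.le
  have hκ0 : 0 ≤ κ := (kappaS_pos d ha hC h.r_pos).le
  have hκr : κ ≤ r := kappaS_le d aminus aplus Cup r
  have hden : 0 < Λ * d + 1 := by positivity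
  have hA : |a| ≤ max |aminus| |aplus| := abs_le_max_abs_abs ha1 ha2
  -- the Lipschitz constant at `a` is dominated by the one at `A = max(|a₋|,|a₊|)`
  have hΛa : boundMS d |a| Cup / r ≤ Λ := by
    rw [hΛdef]; unfold LamS
    exact div_le_div_of_nonneg_right (boundMS_mono d hA hC) h.r_pos.le
  have hsmall' : Λ * (d * κ) ≤ cS d aminus := by
    have h1 : κ ≤ cS d aminus / (Λ * d + 1) := min_le_right _ _
    have h2 : Λ * d * κ ≤ Λ * d * (cS d aminus / (Λ * d + 1)) := mul_le_mul_of_nonneg_left h1 (by positivity)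
    have h3 : Λ * d * (cS d aminus / (Λ * d + 1)) ≤ cS d aminus := by
      rw [mul_div_assoc', div_le_iff₀ hden]
      have := cS_pos d ha
      nlinarith
    calc Λ * (d * κ) = Λ * d * κ := by ring
      _ ≤ cS d aminus := h2.trans h3
  have hca : cS d aminus ≤ a * (4 / Real.pi ^ 2) ^ d / 2 := by
    unfold cS
    have : (0:ℝ) ≤ (4 / Real.pi ^ 2) ^ d / 2 := by positivity
    nlinarith
  have hsmall : boundMS d |a| Cup / r * (d * κ) ≤ a * (4 / Real.pi ^ 2) ^ d / 2 :=
    le_trans (le_trans (mul_le_mul_of_nonneg_right hΛa (by positivity)) hsmall') hca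
  intro p hp
  exact hca.trans (ES_strip_lower h hn ha0 hκ0 hκr hsmall p hp)

/-- the strip of the class lies in the fat region. [folklore] -/
theorem stripS_subset_fat (h : SymbS n σ r CS Cup) (aminus aplus : ℝ) :
    Strip d (kappaS d aminus aplus Cup r) ⊆ Fat d r :=
  B4StripCauchy.strip_subset_fat h.r_pos.le (kappaS_le d aminus aplus Cup r)

/-- **PACKAGED STRIP DATA OVER THE CLASS** (b05's `inverse145_analytic_inputs` shape): on `Strip d κ_S`, for every `a ∈ [a₋, a₊]`,
`ES ≠ 0`, `c_S ≤ ‖ES‖ ≤ M_S(d, max(|a₋|,|a₊|), C_up)`, and `ES` is holomorphic (jointly) at every point. [folklore] -/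
theorem strip_data [NeZero n] (h : SymbS n σ r CS Cup) {aminus aplus a : ℝ} (ha : 0 < aminus)
    (ha1 : aminus ≤ a) (ha2 : a ≤ aplus) {p : Fin d → ℂ} (hp : p ∈ Strip d (kappaS d aminus aplus Cup r)) :
    ES n σ a p ≠ 0 ∧ cS d aminus ≤ ‖ES n σ a p‖ ∧ ‖ES n σ a p‖ ≤ boundMS d (max |aminus| |aplus|) Cup ∧
      DifferentiableAt ℂ (ES n σ a) p := by
  have hq : p ∈ Fat d r := stripS_subset_fat h aminus aplus hp
  have hlow := uniformStrip h ha ha1 ha2 p hp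
  have hc := cS_pos d ha
  refine ⟨fun e => ?_, hlow, ?_, h.differentiableAt_ES a hq⟩
  · rw [e, norm_zero] at hlow; linarith
  · exact (h.norm_ES_le a hq).trans (boundMS_mono d (abs_le_max_abs_abs ha1 ha2) h.cup_nonneg)

/-! ### §3 The `2π`-shift law of `ES` -/

/-- `2πn·m`-periodicity in one coordinate, `m ∈ ℕ`. [folklore] -/
theorem periodic_mul (h : SymbS n σ r CS Cup) (q : Fin d → ℂ) (μ : Fin d) (m : ℕ) :
    σ (Function.update q μ (q μ + 2 * Real.pi * n * m)) = σ q := by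
  induction m with
  | zero => simp
  | succ m ih =>
    have step := h.periodic (Function.update q μ (q μ + 2 * Real.pi * n * m)) μ
    rw [Function.update_self, Function.update_idem] at step
    have e : q μ + 2 * Real.pi * n * ((m + 1 : ℕ) : ℂ) = q μ + 2 * Real.pi * n * m + 2 * Real.pi * n := by
      push_cast; ring
    rw [e, step, ih]

/-- the shifted translate as an update of the relabelled shift: `shift k (p + 2πe_μ) = (shift (σ_μ k) p)[μ ↦ · + 2πn·⌊(k_μ+1)∕n⌋]`
(the wrap `k_μ = n − 1 ↦ 0` produces one period `2πn`, otherwise nothing). [folklore] -/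
theorem shift_tr_eq_update (n : ℕ) [NeZero n] (k : Fin d → Fin n) (p : Fin d → ℂ) (μ : Fin d) :
    shift n k (tr p μ) = Function.update (shift n (sigma n μ k) p) μ
      (shift n (sigma n μ k) p μ + 2 * Real.pi * n * ((((k μ : ℕ) + 1) / n : ℕ) : ℂ)) := by
  funext ν
  by_cases hν : ν = μ
  · subst hν
    rw [Function.update_self]
    simp only [shift, tr_apply_self, sigma_apply_self, val_add_one_eq_mod]
    have e : (((k ν : ℕ) + 1 : ℕ) : ℂ) = ((n * (((k ν : ℕ) + 1) / n) + ((k ν : ℕ) + 1) % n : ℕ) : ℂ) := by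
      rw [Nat.div_add_mod]
    push_cast at e
    linear_combination (2 * Real.pi : ℂ) * e
  · rw [Function.update_of_ne hν]
    simp only [shift, tr_apply_of_ne hν, sigma_apply_of_ne n hν]

/-- **the residue relabelling under `2π`-translation, over the class**: `σ(shift k (p + 2πe_μ)) = σ(shift (σ_μ k) p)` for EVERY `p`
(b05's `DeltaXi_shift_tr`; here from (S1)). [folklore] -/
theorem sigma_shift_tr [NeZero n] (h : SymbS n σ r CS Cup) (k : Fin d → Fin n) (p : Fin d → ℂ) (μ : Fin d) :
    σ (shift n k (tr p μ)) = σ (shift n (sigma n μ k) p) := by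
  rw [shift_tr_eq_update]
  exact periodic_mul h _ μ _

/-- `σ(p + 2πe_μ) = σ(shift (σ_μ 0) p)` (the `k = 0` instance). [folklore] -/
theorem sigma_tr [NeZero n] (h : SymbS n σ r CS Cup) (p : Fin d → ℂ) (μ : Fin d) :
    σ (tr p μ) = σ (shift n (sigma n μ (fun _ => 0)) p) := by
  have := sigma_shift_tr h (fun _ => 0) p μ
  rwa [shift_zero] at this

/-- the periodic factor `B_σ = 1 + a·Σ_k U_k ∕ σ(· + 2πk)` of the regrouping `ES = σ·B_σ`. [folklore] -/
def BfacS (n : ℕ) [NeZero n] (σ : (Fin d → ℂ) → ℂ) (a : ℝ) (p : Fin d → ℂ) : ℂ :=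
  1 + a * ∑ k : Fin d → Fin n, U n k p / σ (shift n k p)

/-- `ES = σ · B_σ` where `σ(p) ≠ 0` (b04's `E_eq_mul` over a general symbol). [folklore] -/
theorem ES_eq_mul_BfacS (n : ℕ) [NeZero n] (σ : (Fin d → ℂ) → ℂ) (a : ℝ) (p : Fin d → ℂ) (h0 : σ p ≠ 0) :
    ES n σ a p = σ p * BfacS n σ a p := by
  unfold ES BfacS
  rw [← Finset.add_sum_erase Finset.univ _ (Finset.mem_univ (fun _ => (0 : Fin n))), shift_zero]
  have e2 : ∑ k ∈ Finset.univ.erase (fun _ => (0 : Fin n)), U n k p * (σ p / σ (shift n k p))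
      = σ p * ∑ k ∈ Finset.univ.erase (fun _ => (0 : Fin n)), U n k p / σ (shift n k p) := by
    rw [Finset.mul_sum]; exact Finset.sum_congr rfl (fun k _ => by ring)
  rw [e2]
  generalize (∑ k ∈ Finset.univ.erase (fun _ => (0 : Fin n)), U n k p / σ (shift n k p)) = S
  field_simp
  ring

/-- `B_σ` is `2π`-periodic in each coordinate off `p_μ ∈ {0, −2π}` (relabel `k ↦ σ_μ k`; b05's `Bfac_tr` over S). [folklore] -/
theorem BfacS_tr [NeZero n] (h : SymbS n σ r CS Cup) (a : ℝ) (p : Fin d → ℂ) (μ : Fin d) (hz : p μ ≠ 0)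
    (hz' : p μ + 2 * Real.pi ≠ 0) : BfacS n σ a (tr p μ) = BfacS n σ a p := by
  unfold BfacS
  congr 2
  simp_rw [U_tr n _ p μ hz hz', sigma_shift_tr h _ p μ]
  exact Equiv.sum_comp (sigmaEquiv n μ) (fun k => U n k p / σ (shift n k p))

/-- **THE SHIFT LAW OF `ES` OVER THE CLASS**: `ES(p + 2πe_μ)·σ(p) = σ(p + 2πe_μ)·ES(p)` where `p_μ ∉ {0, −2π}` and `σ` vanishes at
neither point (b05's `E_tr` over S) — `ES` is not periodic, `ES∕σ = B_σ` is. [folklore] -/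
theorem ES_tr [NeZero n] (h : SymbS n σ r CS Cup) (a : ℝ) (p : Fin d → ℂ) (μ : Fin d) (hz : p μ ≠ 0)
    (hz' : p μ + 2 * Real.pi ≠ 0) (h0 : σ p ≠ 0) (h1 : σ (tr p μ) ≠ 0) :
    ES n σ a (tr p μ) * σ p = σ (tr p μ) * ES n σ a p := by
  rw [ES_eq_mul_BfacS n σ a _ h1, ES_eq_mul_BfacS n σ a _ h0, BfacS_tr h a p μ hz hz']
  ring

end Summit.QuantumFields.BalabanUV.T4Continuum.NE7K1LinStripClassCauchy

end
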